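import Summits.QuantumFields.YangMills.Theses.UnitScaleTilt
import Summits.QuantumFields.YangMills.Theorems.UnitScaleTiltHistoryTailFirstOrderLoops
import Summits.QuantumFields.YangMills.Theorems.UnitScaleTiltHistoryTailStokesLocal
import Literature.Analysis.Calculus.HardyExteriorDecay

/-!
# Route `UnitScaleTilt` — crux K2 `HistoryTail` (stmt-QuantumFields-18916): THE COARSE PLAQUETTE OF THE (0.4)-AVERAGED FIELD TO FIRST
# ORDER UNDER LOCAL SMALLNESS — the hypotheses of `AvgActionDefect.dist1_plaqHol_avgFun_le_mean_add` (p437295) reduced to the loop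
# variables at the four bonds of the coarse plaquette, hence to the plaquettes near its block (support file; brick S3-loc₂b)

Fleet lead `ym-ust-18916-p1` (gen 0); split card `CARD-18916-K2-split.md` (evidence #12/#16), remaining piece **S3-loc**, second brick.
p437295 (`dist1_plaqHol_avgFun_le_mean_add`, seat ym3-torus-p1 g8) proves
`|Ū(∂p′) − 1| ≤ L^{−d} Σ_r Σ_{t,s} |U(∂q_{r,s,t}) − 1| + 435t²` under the GLOBAL `PlaqSmall a U`; its proof consumes that hypothesis only
through the loop variables `W_c(i)` of (0.4) at the FOUR bonds `c₁ … c₄` of `p′` (`|W_c(i) − 1| ≤ t`, the correction factors to first order,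
`|corr(c) − 1| ≤ 6t`).  The sibling file `UnitScaleTiltHistoryTailFirstOrderLoops` restates the theorem with exactly those loop bounds as hypotheses
(`HistoryTailFirstOrderLoops.dist1_plaqHol_avgFun_le_mean_add_of_loops`); THIS FILE feeds them from the WALK-LOCAL plaquette smallness of
`HistoryTailStokesLocal.dist1_loopHol_le_loc` (p443816): **`dist1_plaqHol_avgFun_le_mean_add_loc`** — if every plaquette cornered at a site
`walkEnd (emb c₋) v`, `|v| ≤ (d+2)L + 2`, is within `a` of `1` for each of the four bonds `c` of `p′`, and `t = ((d+2)L)²a/4 ≤ 1/10`, `t < δ_N`,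
then the displayed first-order bound holds; and its `(1+ε)`-sharp square **`dist1_sq_avgFun_le_loc`** (local twin of
`HistoryTailStokesStep.dist1_sq_avgFun_le`, p442112).  This is the localisation the composite minimisers of (41) need ([Balaban1985UV3] (68):
regularity only on `B^j(Λ_j)`).

WHAT THIS IS NOT: the region/iteration/(71) twins (S3b-loc, S3c-loc) are mechanical from here but not in this file; nothing of (41)/(47);
nothing uses (α).
-/

noncomputable section

open NormedSpace
open scoped BigOperators Matrix.Norms.L2Operator

namespace Summit.QuantumFields.YangMills.Theorems.HistoryTailFirstOrderLocal

open Literature.MathematicalPhysics.QuantumFieldTheory.Balaban1983to89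
open T4Continuum BlockAveraging AveragingRT B10Eq47AxialChi ExpMeanLog LatticeWordStokes BlockAveragingPlaquetteBound
open Summit.QuantumFields.YangMills.Theorems.HistoryTailFirstOrderLoops (dist1_plaqHol_avgFun_le_mean_add_of_loops)
open Summit.QuantumFields.YangMills.Theorems.HistoryTailStokesLocal (dist1_loopHol_le_loc)
open Literature.Analysis.Calculus (add_sq_le_eps)

variable {n : Type*} [Fintype n] [DecidableEq n] [Nonempty n] {P : Params} {j : ℕ}

/-! ## §3 From walk-local plaquette smallness around the block -/

section Local

/-- **THE FIRST-ORDER COARSE PLAQUETTE UNDER WALK-LOCAL PLAQUETTE SMALLNESS**: if for each of the four bonds `c` of `p′` every plaquette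
cornered at a site `walkEnd (emb c₋) v`, `|v| ≤ (d+2)L + 2`, is within `a ≥ 0` of `1`, and `t = ((d+2)L)²a/4 ≤ 1/10`, `t < δ_N`, then
`|Ū(∂p′) − 1| ≤ L^{−d} Σ_r Σ_{t′,s} |U(∂q_{r,s,t′}) − 1| + 435t²` (loop bounds by `HistoryTailStokesLocal.dist1_loopHol_le_loc`).
[cite: Balaban1987RG1, (0.4) p.253; Balaban1985UV3, (68) p.273] -/
theorem dist1_plaqHol_avgFun_le_mean_add_loc (hj : j + 1 ≤ P.m + P.K) {a : ℝ} (ha : 0 ≤ a)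
    {U : GaugeField P j (Matrix.specialUnitaryGroup n ℂ)}
    (ht : ((((P.d + 2) * P.L : ℕ) : ℝ) ^ 2 / 4) * a ≤ 1 / 10) (hδ : ((((P.d + 2) * P.L : ℕ) : ℝ) ^ 2 / 4) * a < deltaSU n)
    (p : Plaq P (j + 1))
    (hloc : ∀ c : PBond P (j + 1), (c = ⟨p.src, p.μ⟩ ∨ c = ⟨p.src.shift p.μ, p.ν⟩ ∨ c = ⟨p.src.shift p.ν, p.μ⟩ ∨ c = ⟨p.src, p.ν⟩) →
      ∀ v : List (Letter P.d), v.length ≤ (P.d + 2) * P.L + 2 →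
        ∀ (a' b' : Fin P.d) (h : a' < b'), dist1 (GaugeField.plaqHol U ⟨walkEnd (emb c.src) v, a', b', h⟩) ≤ a) :
    dist1 (GaugeField.plaqHol (avgFun (expMeanLogSU (n := n)) U) p) ≤
      ((P.L : ℝ) ^ P.d)⁻¹ * ∑ r : Fin P.d → Fin P.L, ∑ t ∈ Finset.range P.L, ∑ s ∈ Finset.range P.L,
          dist1 (GaugeField.plaqHol U ⟨shiftN (shiftN (Site.blockSite p.src r) p.ν t) p.μ s, p.μ, p.ν, p.hμν⟩) +
        435 * (((((P.d + 2) * P.L : ℕ) : ℝ) ^ 2 / 4) * a) ^ 2 := by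
  refine dist1_plaqHol_avgFun_le_mean_add_of_loops hj ht hδ p fun i => ⟨?_, ?_, ?_, ?_⟩
  · exact dist1_loopHol_le_loc U ha _ (hloc _ (Or.inl rfl)) i
  · exact dist1_loopHol_le_loc U ha _ (hloc _ (Or.inr (Or.inl rfl))) i
  · exact dist1_loopHol_le_loc U ha _ (hloc _ (Or.inr (Or.inr (Or.inl rfl)))) i
  · exact dist1_loopHol_le_loc U ha _ (hloc _ (Or.inr (Or.inr (Or.inr rfl)))) i

/-- **ITS `(1+ε)`-SHARP SQUARE** (local twin of `HistoryTailStokesStep.dist1_sq_avgFun_le`): under the same walk-local hypothesis, for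
every `ε > 0`, `|Ū(∂p′) − 1|² ≤ (1+ε)·L²(L^d)⁻¹·Σ_r Σ_{t,s}|U(∂q_{r,s,t}) − 1|² + (1+ε⁻¹)(435t²)²`.
[cite: Balaban1985UV3, (69)-(70) p.273; Balaban1987RG1, (0.4) p.253] -/
theorem dist1_sq_avgFun_le_loc (hj : j + 1 ≤ P.m + P.K) {a : ℝ} (ha : 0 ≤ a)
    {U : GaugeField P j (Matrix.specialUnitaryGroup n ℂ)}
    (ht : ((((P.d + 2) * P.L : ℕ) : ℝ) ^ 2 / 4) * a ≤ 1 / 10) (hδ : ((((P.d + 2) * P.L : ℕ) : ℝ) ^ 2 / 4) * a < deltaSU n)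
    {ε : ℝ} (hε : 0 < ε) (p : Plaq P (j + 1))
    (hloc : ∀ c : PBond P (j + 1), (c = ⟨p.src, p.μ⟩ ∨ c = ⟨p.src.shift p.μ, p.ν⟩ ∨ c = ⟨p.src.shift p.ν, p.μ⟩ ∨ c = ⟨p.src, p.ν⟩) →
      ∀ v : List (Letter P.d), v.length ≤ (P.d + 2) * P.L + 2 →
        ∀ (a' b' : Fin P.d) (h : a' < b'), dist1 (GaugeField.plaqHol U ⟨walkEnd (emb c.src) v, a', b', h⟩) ≤ a) :
    dist1 (GaugeField.plaqHol (avgFun (expMeanLogSU (n := n)) U) p) ^ 2 ≤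
      (1 + ε) * ((P.L : ℝ) ^ 2 * ((P.L : ℝ) ^ P.d)⁻¹) *
          ∑ r : Fin P.d → Fin P.L, ∑ t ∈ Finset.range P.L, ∑ s ∈ Finset.range P.L,
            dist1 (GaugeField.plaqHol U ⟨shiftN (shiftN (Site.blockSite p.src r) p.ν t) p.μ s, p.μ, p.ν, p.hμν⟩) ^ 2 +
        (1 + ε⁻¹) * (435 * (((((P.d + 2) * P.L : ℕ) : ℝ) ^ 2 / 4) * a) ^ 2) ^ 2 := by
  set τ : ℝ := ((((P.d + 2) * P.L : ℕ) : ℝ) ^ 2 / 4) * a with hτ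
  set R : ℝ := 435 * τ ^ 2 with hR
  have hL : (0 : ℝ) < P.L := Nat.cast_pos.mpr P.L_pos
  have hLd : (0 : ℝ) < (P.L : ℝ) ^ P.d := by positivity
  let D : (Fin P.d → Fin P.L) → ℝ := fun r =>
    ∑ t ∈ Finset.range P.L, ∑ s ∈ Finset.range P.L,
      dist1 (GaugeField.plaqHol U ⟨shiftN (shiftN (Site.blockSite p.src r) p.ν t) p.μ s, p.μ, p.ν, p.hμν⟩)
  let D₂ : (Fin P.d → Fin P.L) → ℝ := fun r =>
    ∑ t ∈ Finset.range P.L, ∑ s ∈ Finset.range P.L,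
      dist1 (GaugeField.plaqHol U ⟨shiftN (shiftN (Site.blockSite p.src r) p.ν t) p.μ s, p.μ, p.ν, p.hμν⟩) ^ 2
  have hM := dist1_plaqHol_avgFun_le_mean_add_loc (n := n) hj ha ht hδ p hloc
  set M : ℝ := ((P.L : ℝ) ^ P.d)⁻¹ * ∑ r : Fin P.d → Fin P.L, D r with hMdef
  have hM' : dist1 (GaugeField.plaqHol (avgFun (expMeanLogSU (n := n)) U) p) ≤ M + R := hM
  have hJ : M ^ 2 ≤ ((P.L : ℝ) ^ P.d)⁻¹ * ∑ r : Fin P.d → Fin P.L, D r ^ 2 := by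
    have h := sq_sum_le_card_mul_sum_sq (s := (Finset.univ : Finset (Fin P.d → Fin P.L))) (f := fun r => D r)
    rw [Finset.card_univ, Fintype.card_fun, Fintype.card_fin, Fintype.card_fin] at h
    push_cast at h
    rw [hMdef, mul_pow]
    calc (((P.L : ℝ) ^ P.d)⁻¹) ^ 2 * (∑ r, D r) ^ 2 ≤ (((P.L : ℝ) ^ P.d)⁻¹) ^ 2 * ((P.L : ℝ) ^ P.d * ∑ r, D r ^ 2) :=
          mul_le_mul_of_nonneg_left h (sq_nonneg _)
      _ = ((P.L : ℝ) ^ P.d)⁻¹ * ∑ r, D r ^ 2 := by field_simp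
  have hCS : ∀ r, D r ^ 2 ≤ (P.L : ℝ) ^ 2 * D₂ r := by
    intro r
    have h1 := sq_sum_le_card_mul_sum_sq (s := Finset.range P.L) (f := fun t => ∑ s ∈ Finset.range P.L,
      dist1 (GaugeField.plaqHol U ⟨shiftN (shiftN (Site.blockSite p.src r) p.ν t) p.μ s, p.μ, p.ν, p.hμν⟩))
    have h2 : ∀ t ∈ Finset.range P.L, (∑ s ∈ Finset.range P.L,
        dist1 (GaugeField.plaqHol U ⟨shiftN (shiftN (Site.blockSite p.src r) p.ν t) p.μ s, p.μ, p.ν, p.hμν⟩)) ^ 2 ≤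
        P.L * ∑ s ∈ Finset.range P.L,
          dist1 (GaugeField.plaqHol U ⟨shiftN (shiftN (Site.blockSite p.src r) p.ν t) p.μ s, p.μ, p.ν, p.hμν⟩) ^ 2 := by
      intro t _
      have h := sq_sum_le_card_mul_sum_sq (s := Finset.range P.L) (f := fun s =>
        dist1 (GaugeField.plaqHol U ⟨shiftN (shiftN (Site.blockSite p.src r) p.ν t) p.μ s, p.μ, p.ν, p.hμν⟩))
      rwa [Finset.card_range] at h
    rw [Finset.card_range] at h1
    calc D r ^ 2 ≤ P.L * ∑ t ∈ Finset.range P.L, (∑ s ∈ Finset.range P.L,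
          dist1 (GaugeField.plaqHol U ⟨shiftN (shiftN (Site.blockSite p.src r) p.ν t) p.μ s, p.μ, p.ν, p.hμν⟩)) ^ 2 := h1
      _ ≤ P.L * ∑ t ∈ Finset.range P.L, (P.L * ∑ s ∈ Finset.range P.L,
          dist1 (GaugeField.plaqHol U ⟨shiftN (shiftN (Site.blockSite p.src r) p.ν t) p.μ s, p.μ, p.ν, p.hμν⟩) ^ 2) :=
          mul_le_mul_of_nonneg_left (Finset.sum_le_sum h2) hL.le
      _ = (P.L : ℝ) ^ 2 * D₂ r := by rw [← Finset.mul_sum]; ring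
  have hJ2 : M ^ 2 ≤ ((P.L : ℝ) ^ 2 * ((P.L : ℝ) ^ P.d)⁻¹) * ∑ r : Fin P.d → Fin P.L, D₂ r := by
    calc M ^ 2 ≤ ((P.L : ℝ) ^ P.d)⁻¹ * ∑ r : Fin P.d → Fin P.L, D r ^ 2 := hJ
      _ ≤ ((P.L : ℝ) ^ P.d)⁻¹ * ∑ r : Fin P.d → Fin P.L, (P.L : ℝ) ^ 2 * D₂ r :=
          mul_le_mul_of_nonneg_left (Finset.sum_le_sum fun r _ => hCS r) (inv_nonneg.mpr hLd.le)
      _ = ((P.L : ℝ) ^ 2 * ((P.L : ℝ) ^ P.d)⁻¹) * ∑ r : Fin P.d → Fin P.L, D₂ r := by rw [← Finset.mul_sum]; ring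
  have h0 : 0 ≤ dist1 (GaugeField.plaqHol (avgFun (expMeanLogSU (n := n)) U) p) := GaugeGroup.dist1_nonneg _
  have hε1 : 0 ≤ 1 + ε := by linarith
  calc dist1 (GaugeField.plaqHol (avgFun (expMeanLogSU (n := n)) U) p) ^ 2 ≤ (M + R) ^ 2 :=
        pow_le_pow_left₀ h0 hM' 2
    _ ≤ (1 + ε) * M ^ 2 + (1 + ε⁻¹) * R ^ 2 := add_sq_le_eps M R hε
    _ ≤ (1 + ε) * (((P.L : ℝ) ^ 2 * ((P.L : ℝ) ^ P.d)⁻¹) * ∑ r : Fin P.d → Fin P.L, D₂ r) + (1 + ε⁻¹) * R ^ 2 := by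
        gcongr
    _ = _ := by ring

end Local

end Summit.QuantumFields.YangMills.Theorems.HistoryTailFirstOrderLocal

end
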